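import Summits.PneNP.PneNP.Theorems.SymmetryBudgetNoHiddenOrderPerPathCanonRealise
import Summits.PneNP.PneNP.Theorems.SymmetryBudgetNoHiddenOrderPerPathCanonInvariance

/-!
# A complete graph invariant from the components-only Corneil–Goldberg recursion (`NoHiddenOrder`, PER-PATH.md §12.2, B2+B3)

Route `PneNP/SymmetryBudget`, `NoHiddenOrder` (stmt-PneNP-14781). Putting realisation
(`SymmetryBudgetNoHiddenOrderPerPathCanonRealise.lean`) and label invariance (`SymmetryBudgetNoHiddenOrderPerPathCanonInvariance.lean`)
of the canonical copy `canon` together: the CANONICAL FORM of a finite graph,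

  `canonForm G := canon G univ (refineIn G univ 0)` (start from the coarsest equitable colouring, which is label-invariant),

is a complete isomorphism invariant: `canonForm G = canonForm H ↔ Nonempty (G ≃g H)` (`canonForm_eq_iff`). This is the
function computed by the components-only Corneil–Goldberg canoniser (B. Laubner, PhD thesis HU Berlin 2011, §3.4; D. G. Corneil,
M. Goldberg 1984) whose recursion tree has linear per-path branching (`ORSteps.sum_log_d_le`) — the function-level half of
(R2a); the symmetric-circuit compilation (R2b/c) is what remains for `NoHiddenOrder`.

Main definitions: `canonForm`. Main results: `canonForm_eq_of_iso`, `nonempty_iso_of_canonForm_eq`, `canonForm_eq_iff`.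
-/

-- `Summit.PneNP.PneNP.…` duplicates `PneNP` BY DESIGN (single-problem summit, D-0017 layout).
set_option linter.dupNamespace false

namespace Summit.PneNP.PneNP.Theorems

open Finset

namespace BranchSum

variable {V W : Type*} [Fintype V] [DecidableEq V] [Fintype W] [DecidableEq W]
  (G : SimpleGraph V) [DecidableRel G.Adj] (H : SimpleGraph W) [DecidableRel H.Adj]

/-- **The canonical form of a finite graph**: the canonical copy of the whole vertex set, started from the coarsest equitable
colouring `refineIn G univ 0`. -/
noncomputable def canonForm : Enc := canon G univ (refineIn G univ fun _ => 0)

variable {G H}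

/-- The start colouring is equitable inside `univ`. -/
theorem equitableIn_start :
    ∀ u ∈ (univ : Finset V), ∀ v ∈ (univ : Finset V), refineIn G univ (fun _ => 0) u = refineIn G univ (fun _ => 0) v →
      ∀ w ∈ (univ : Finset V),
        ((cellOf univ (refineIn G univ fun _ => 0) w).filter fun y => G.Adj u y).card =
          ((cellOf univ (refineIn G univ fun _ => 0) w).filter fun y => G.Adj v y).card :=
  fun _ hu _ hv huv _ hw => equitableIn_refineIn univ (fun _ => 0) hu hv huv hw

/-- **Isomorphic graphs have the same canonical form.** -/
theorem canonForm_eq_of_iso (φ : H ≃g G) : canonForm H = canonForm G := by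
  unfold canonForm
  have hAB : ∀ w, w ∈ (univ : Finset W) ↔ φ w ∈ (univ : Finset V) := fun w => by simp
  have hadj : ∀ a b, H.Adj a b ↔ G.Adj (φ a) (φ b) := fun a b => φ.map_rel_iff.symm
  have h := canon_equiv (G := G) (H := H) φ.toEquiv hadj hAB (refineIn G univ fun _ => 0)
  rw [← refineIn_equiv φ.toEquiv hadj hAB] at h
  exact h

/-- **Graphs with the same canonical form are isomorphic.** -/
theorem nonempty_iso_of_canonForm_eq (h : canonForm G = canonForm H) : Nonempty (G ≃g H) := by
  obtain ⟨l, l', hl, hl', hlA, hlB, hlen, hmatch⟩ :=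
    exists_matching_enum_of_canon_eq (G := G) (H := H) equitableIn_start equitableIn_start h
  have hml : ∀ v, v ∈ l := fun v => by rw [← List.mem_toFinset, hlA]; exact mem_univ v
  have hml' : ∀ w, w ∈ l' := fun w => by rw [← List.mem_toFinset, hlB]; exact mem_univ w
  let eV : Fin l.length ≃ V := hl.getEquivOfForallMemList l hml
  let eW : Fin l'.length ≃ W := hl'.getEquivOfForallMemList l' hml'
  refine ⟨⟨eV.symm.trans ((finCongr hlen).trans eW), ?_⟩⟩
  intro a b
  obtain ⟨i, rfl⟩ := eV.surjective a
  obtain ⟨k, rfl⟩ := eV.surjective b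
  simp only [Equiv.trans_apply, Equiv.symm_apply_apply]
  simp only [finCongr_apply, eV, eW, List.Nodup.getEquivOfForallMemList_apply, List.get_eq_getElem, Fin.val_cast]
  exact ((hmatch i i.2).2 k k.2).symm

/-- **The canonical form is a complete isomorphism invariant.** -/
theorem canonForm_eq_iff : canonForm G = canonForm H ↔ Nonempty (G ≃g H) :=
  ⟨nonempty_iso_of_canonForm_eq, fun ⟨φ⟩ => canonForm_eq_of_iso φ⟩

end BranchSum

end Summit.PneNP.PneNP.Theorems
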